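import Summits.HodgeConjecture.CorCM.Census.CentralSquaresPartnersMixedLaw
import Summits.HodgeConjecture.CorCM.Census.CentralSquaresPartnersFar

/-!
# The square-central class, LXII: the mixed multi-partner law from INTERSECTION COUNTS

COR-CM (cell `pub-hodgecm2`), count-neutral kernel combinatorics by the binder seat b09 (gen 50; lane SQUARE-CENTRAL CLASS, part LXII), on part LXI
(`isLeast_card_gfaces_generate_partners_mixed`, `pair_exchange_partners`), part LVII (`tie_of_inter_bounds`, `tieC_of_inter_bounds`), part LVIII
(`far_of_inter_bounds`), part LI (`hbase_exchange_partners`, `card_sdiff_exchange_partners`), parts III, VI, VII (`ddist_eq_card_symmDiff`, `ddist_compl_eq`,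
`card_frame`, `companion_card`, `dev_compl`), BY NAME.  Theorems only: no definition, no `decide`, no certificate, no named fact, no `sorry`.  HONEST FRAMING:
`HC_CM` is NOT proved, here or anywhere in the tree; nothing here is a period or a headline.

**THE COUNT FORM OF THE MIXED MULTI-PARTNER LAW (`isLeast_card_gfaces_generate_partners_mixed_of_counts`).**  Part LXIʼs law with every tie and far
hypothesis — in the frame of `T₀` for the direct partners and in the frame of the direct partner `T₁` for the indirect ones — replaced by intersection counts
(`1 … m−1` for the ties, `3 … m−3` for the far partners), which is what a model of the rank-two affine block of Pauli `× E` computes (all counts `m/2`).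

## References
* [Pohlmann1968] H. Pohlmann, Algebraic cycles on abelian varieties of complex multiplication type, Ann. of Math. 88 (1968), Thm 1.
* [Milne1999] J. S. Milne, Lefschetz motives and the Tate conjecture, Compositio Math. 117 (1999), Prop. 2.1, p. 54.
-/

namespace Summit.HodgeConjecture.CorCM.Census.CentralSquares

open Finset
open scoped symmDiff
open Summit.HodgeConjecture.CorCM.Prior.AllgGroup.RfwfAllgGroup
open Summit.HodgeConjecture.CorCM.Census.BlockParity
open Summit.HodgeConjecture.CorCM.Census.Coinvariant
open Summit.HodgeConjecture.CorCM.Census.TwistGeneration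
open Summit.HodgeConjecture.CorCM.Census.BaseBlock
open Summit.HodgeConjecture.CorCM.Census.CoverClosure

noncomputable section

variable {G : Type*} [Group G] [Fintype G] [DecidableEq G] (c : G)

/-- **Tie and far hypotheses from counts, in the frame of any base type `B` with partner `P`** — the four conversions used twice below. [folklore] -/
theorem frame_data_of_counts (hc2 : c * c = 1) (hcen : ∀ x : G, x * c = c * x) (B : CMF G c) (𝒮 : Finset (CMF G c))
    (hbase : ∀ Q : G, rt c Q B = B ∨ rt c Q B = rt c c B ∨ ∃ P ∈ 𝒮, rt c Q B = P ∨ rt c Q B = rt c c P)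
    (m : ℕ) (hm : 3 ≤ m) (hn : B.1.card = 4 * m) (hH : ∀ P ∈ 𝒮, (B.1 \ P.1).card = 2 * m)
    (hpair : ∀ P ∈ 𝒮, ∀ P' ∈ 𝒮, P ≠ P' → ((B.1 \ P.1) ∆ (B.1 \ P'.1)).card = 2 * m)
    {P : CMF G c} (hP𝒮 : P ∈ 𝒮) (Q : G) (T T' : Finset G) (hTH : T ⊆ B.1 \ P.1) (hTm : T.card = m) (hTH' : T' ⊆ B.1 ∩ P.1) (hTm' : T'.card = m)
    (hcU : ∀ U : Finset G, U ⊆ B.1 \ P.1 → U.card = m →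
      (∀ t ∈ B.1 \ P.1, ∀ t' ∈ B.1, (t' = t * Q ∨ t' = c * (t * Q)) → (t ∈ U ↔ t' ∉ U)) →
      ∀ P₂ ∈ 𝒮, P₂ ≠ P → 0 < (U ∩ (B.1 \ P₂.1)).card ∧ (U ∩ (B.1 \ P₂.1)).card < m)
    (hcU' : ∀ U' : Finset G, U' ⊆ B.1 ∩ P.1 → U'.card = m →
      (∀ t ∈ B.1 ∩ P.1, ∀ t' ∈ B.1, (t' = t * Q ∨ t' = c * (t * Q)) → (t ∈ U' ↔ t' ∉ U')) →
      ∀ P₂ ∈ 𝒮, P₂ ≠ P → 0 < (U' ∩ (B.1 \ P₂.1)).card ∧ (U' ∩ (B.1 \ P₂.1)).card < m)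
    (hcfar : ∀ P₂ ∈ 𝒮, P₂ ≠ P →
      (3 ≤ (T ∩ (B.1 \ P₂.1)).card ∧ (T ∩ (B.1 \ P₂.1)).card + 3 ≤ m) ∧
      (3 ≤ (((B.1 \ P.1) \ T).image (fun x => c * x) ∩ (P.1 \ P₂.1)).card ∧
        (((B.1 \ P.1) \ T).image (fun x => c * x) ∩ (P.1 \ P₂.1)).card + 3 ≤ m) ∧
      (3 ≤ (T' ∩ (B.1 \ P₂.1)).card ∧ (T' ∩ (B.1 \ P₂.1)).card + 3 ≤ m) ∧
      (3 ≤ (((B.1 \ (rt c c P).1) \ T').image (fun x => c * x) ∩ ((rt c c P).1 \ P₂.1)).card ∧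
        (((B.1 \ (rt c c P).1) \ T').image (fun x => c * x) ∩ ((rt c c P).1 \ P₂.1)).card + 3 ≤ m)) :
    (∀ U : Finset G, U ⊆ B.1 \ P.1 → U.card = m →
      (∀ t ∈ B.1 \ P.1, ∀ t' ∈ B.1, (t' = t * Q ∨ t' = c * (t * Q)) → (t ∈ U ↔ t' ∉ U)) →
      ∀ X : CMF G c, B.1 \ X.1 = U → ∀ Q' : G, ddist (rt c Q' B) X = m → rt c Q' B = B ∨ rt c Q' B = P) ∧
    (∀ U' : Finset G, U' ⊆ B.1 ∩ P.1 → U'.card = m →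
      (∀ t ∈ B.1 ∩ P.1, ∀ t' ∈ B.1, (t' = t * Q ∨ t' = c * (t * Q)) → (t ∈ U' ↔ t' ∉ U')) →
      ∀ X : CMF G c, B.1 \ X.1 = U' → ∀ Q' : G, ddist (rt c Q' B) X = m → rt c Q' B = B ∨ rt c Q' B = rt c c P) ∧
    (∀ a ∈ B.1 ∩ P.1, ∀ a' ∈ B.1, (a' = a * Q ∨ a' = c * (a * Q)) →
      (∀ P₂ ∈ 𝒮, P₂ ≠ P → ∀ X : CMF G c, B.1 \ X.1 ⊆ T ∪ {a, a'} →
        (B.1 \ X.1).card < ddist P₂ X ∧ (B.1 \ X.1).card < ddist (rt c c P₂) X) ∧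
      (∀ P₂ ∈ 𝒮, P₂ ≠ P → ∀ X : CMF G c, P.1 \ X.1 ⊆ ((B.1 \ P.1) \ T).image (fun x => c * x) ∪ {a, a'} →
        (P.1 \ X.1).card < ddist P₂ X ∧ (P.1 \ X.1).card < ddist (rt c c P₂) X)) ∧
    (∀ s ∈ B.1 \ P.1, ∀ s' ∈ B.1, (s' = s * Q ∨ s' = c * (s * Q)) →
      (∀ P₂ ∈ 𝒮, P₂ ≠ P → ∀ X : CMF G c, B.1 \ X.1 ⊆ T' ∪ {s, s'} →
        (B.1 \ X.1).card < ddist P₂ X ∧ (B.1 \ X.1).card < ddist (rt c c P₂) X) ∧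
      (∀ P₂ ∈ 𝒮, P₂ ≠ P → ∀ X : CMF G c,
        (rt c c P).1 \ X.1 ⊆ ((B.1 \ (rt c c P).1) \ T').image (fun x => c * x) ∪ {s, s'} →
        ((rt c c P).1 \ X.1).card < ddist P₂ X ∧ ((rt c c P).1 \ X.1).card < ddist (rt c c P₂) X)) := by
  have hm1 : 1 ≤ m := by omega
  have hn₁ : P.1.card = 4 * m := card_frame c hc2 B P m hn
  have hn₁c : (rt c c P).1.card = 4 * m := card_frame c hc2 B (rt c c P) m hn
  have hH₁ : ∀ P₂ ∈ 𝒮, P₂ ≠ P → (P.1 \ P₂.1).card = 2 * m := by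
    intro P₂ hP₂ h12
    have e : (P.1 \ P₂.1).card = ddist P P₂ := rfl
    rw [e, ddist_eq_card_symmDiff c B hc2 P P₂]
    exact hpair P hP𝒮 P₂ hP₂ (Ne.symm h12)
  have hH₁c : ∀ P₂ ∈ 𝒮, P₂ ≠ P → ((rt c c P).1 \ P₂.1).card = 2 * m := by
    intro P₂ hP₂ h12
    have e : ((rt c c P).1 \ P₂.1).card = ddist (rt c c P) P₂ := rfl
    rw [e, ddist_compl_eq c B hc2 hcen P P₂, hn, hpair P hP𝒮 P₂ hP₂ (Ne.symm h12)]
    omega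
  have hcW : (((B.1 \ P.1) \ T).image (fun x => c * x)).card = m := by
    rw [card_image_of_injective _ (mul_right_injective c), card_sdiff_of_subset hTH, hH P hP𝒮, hTm]; omega
  have hHcEq : B.1 \ (rt c c P).1 = B.1 ∩ P.1 := by
    rw [dev_compl c hcen B P]; ext t; simp only [mem_sdiff, mem_inter, not_and, not_not]; tauto
  have hcW' : (((B.1 \ (rt c c P).1) \ T').image (fun x => c * x)).card = m := by
    rw [card_image_of_injective _ (mul_right_injective c), hHcEq, card_sdiff_of_subset hTH']
    have h0 := card_sdiff_add_card_inter B.1 P.1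
    have h1 := hH P hP𝒮
    omega
  refine ⟨?_, ?_, ?_, ?_⟩
  · intro U hUH hUm hU
    exact tie_of_inter_bounds c B 𝒮 hbase m hn hH hc2 hcen hm1 hP𝒮 U hUH hUm (hcU U hUH hUm hU)
  · intro U' hUH hUm hU
    exact tieC_of_inter_bounds c B 𝒮 hbase m hn hH hc2 hcen hm1 hP𝒮 U' hUH hUm (hcU' U' hUH hUm hU)
  · intro a _ a' _ _
    refine ⟨fun P₂ hP₂ h12 => ?_, fun P₂ hP₂ h12 => ?_⟩
    · obtain ⟨⟨h3, h4⟩, -, -, -⟩ := hcfar P₂ hP₂ h12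
      exact far_of_inter_bounds c hc2 hcen B P₂ m hn (hH P₂ hP₂) T hTm h3 h4 a a'
    · obtain ⟨-, ⟨h3, h4⟩, -, -⟩ := hcfar P₂ hP₂ h12
      exact far_of_inter_bounds c hc2 hcen P P₂ m hn₁ (hH₁ P₂ hP₂ h12) _ hcW h3 h4 a a'
  · intro s _ s' _ _
    refine ⟨fun P₂ hP₂ h12 => ?_, fun P₂ hP₂ h12 => ?_⟩
    · obtain ⟨-, -, ⟨h3, h4⟩, -⟩ := hcfar P₂ hP₂ h12
      exact far_of_inter_bounds c hc2 hcen B P₂ m hn (hH P₂ hP₂) T' hTm' h3 h4 s s'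
    · obtain ⟨-, -, -, ⟨h3, h4⟩⟩ := hcfar P₂ hP₂ h12
      exact far_of_inter_bounds c hc2 hcen (rt c c P) P₂ m hn₁c (hH₁c P₂ hP₂ h12) _ hcW' h3 h4 s s'

/-- **THE MIXED MULTI-PARTNER LAW, COUNT FORM.**  Part LXIʼs law with the tie and far hypotheses of every direct partner (in the frame of `T₀`) and of every
indirect partner (in the frame of its direct partner `T₁`, partner set `insert T₀ ((𝒯 ∪ 𝒯').erase T₁)`) replaced by intersection counts. Then
**`μ(G, c) = φ₂(G, c)`**. [folklore] -/
theorem isLeast_card_gfaces_generate_partners_mixed_of_counts (hG : IsPGroup 2 G) (hc2 : c * c = 1) (hc1 : c ≠ 1) (hcen : ∀ x : G, x * c = c * x)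
    (T₀ : CMF G c) (𝒯 𝒯' : Finset (CMF G c)) (h𝒯 : 𝒯.Nonempty)
    (hbase : ∀ Q : G, rt c Q T₀ = T₀ ∨ rt c Q T₀ = rt c c T₀ ∨ ∃ T₁ ∈ 𝒯 ∪ 𝒯', rt c Q T₀ = T₁ ∨ rt c Q T₀ = rt c c T₁)
    (m : ℕ) (hm : 3 ≤ m) (hn : T₀.1.card = 4 * m) (hH : ∀ T₁ ∈ 𝒯 ∪ 𝒯', (T₀.1 \ T₁.1).card = 2 * m)
    (hpair : ∀ T₁ ∈ 𝒯 ∪ 𝒯', ∀ T₂ ∈ 𝒯 ∪ 𝒯', T₁ ≠ T₂ → ((T₀.1 \ T₁.1) ∆ (T₀.1 \ T₂.1)).card = 2 * m)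
    (hframe : ∀ T₁ ∈ 𝒯, ∃ Q : G, ∃ T T' : Finset G,
      rt c Q T₀ = T₁ ∧ Q * Q = 1 ∧
      (∀ t ∈ T₀.1, ∀ t' ∈ T₀.1, (t' = t * Q ∨ t' = c * (t * Q)) → (t ∈ T₀.1 \ T₁.1 ↔ t' ∈ T₀.1 \ T₁.1)) ∧
      (T ⊆ T₀.1 \ T₁.1 ∧ T.card = m ∧ ∀ t ∈ T₀.1 \ T₁.1, ∀ t' ∈ T₀.1, (t' = t * Q ∨ t' = c * (t * Q)) → (t ∈ T ↔ t' ∉ T)) ∧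
      (T' ⊆ T₀.1 ∩ T₁.1 ∧ T'.card = m ∧ ∀ t ∈ T₀.1 ∩ T₁.1, ∀ t' ∈ T₀.1, (t' = t * Q ∨ t' = c * (t * Q)) → (t ∈ T' ↔ t' ∉ T')) ∧
      (∀ U : Finset G, U ⊆ T₀.1 \ T₁.1 → U.card = m →
        (∀ t ∈ T₀.1 \ T₁.1, ∀ t' ∈ T₀.1, (t' = t * Q ∨ t' = c * (t * Q)) → (t ∈ U ↔ t' ∉ U)) →
        ∀ T₂ ∈ 𝒯 ∪ 𝒯', T₂ ≠ T₁ → 0 < (U ∩ (T₀.1 \ T₂.1)).card ∧ (U ∩ (T₀.1 \ T₂.1)).card < m) ∧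
      (∀ U' : Finset G, U' ⊆ T₀.1 ∩ T₁.1 → U'.card = m →
        (∀ t ∈ T₀.1 ∩ T₁.1, ∀ t' ∈ T₀.1, (t' = t * Q ∨ t' = c * (t * Q)) → (t ∈ U' ↔ t' ∉ U')) →
        ∀ T₂ ∈ 𝒯 ∪ 𝒯', T₂ ≠ T₁ → 0 < (U' ∩ (T₀.1 \ T₂.1)).card ∧ (U' ∩ (T₀.1 \ T₂.1)).card < m) ∧
      (∀ T₂ ∈ 𝒯 ∪ 𝒯', T₂ ≠ T₁ →
        (3 ≤ (T ∩ (T₀.1 \ T₂.1)).card ∧ (T ∩ (T₀.1 \ T₂.1)).card + 3 ≤ m) ∧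
        (3 ≤ (((T₀.1 \ T₁.1) \ T).image (fun x => c * x) ∩ (T₁.1 \ T₂.1)).card ∧
          (((T₀.1 \ T₁.1) \ T).image (fun x => c * x) ∩ (T₁.1 \ T₂.1)).card + 3 ≤ m) ∧
        (3 ≤ (T' ∩ (T₀.1 \ T₂.1)).card ∧ (T' ∩ (T₀.1 \ T₂.1)).card + 3 ≤ m) ∧
        (3 ≤ (((T₀.1 \ (rt c c T₁).1) \ T').image (fun x => c * x) ∩ ((rt c c T₁).1 \ T₂.1)).card ∧
          (((T₀.1 \ (rt c c T₁).1) \ T').image (fun x => c * x) ∩ ((rt c c T₁).1 \ T₂.1)).card + 3 ≤ m)))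
    (hframe' : ∀ T₂ ∈ 𝒯', ∃ T₁ ∈ 𝒯, ∃ Q₁ Q : G, ∃ T T' : Finset G,
      rt c Q₁ T₀ = T₁ ∧ rt c Q T₁ = T₂ ∧ Q * Q = 1 ∧
      (∀ t ∈ T₁.1, ∀ t' ∈ T₁.1, (t' = t * Q ∨ t' = c * (t * Q)) → (t ∈ T₁.1 \ T₂.1 ↔ t' ∈ T₁.1 \ T₂.1)) ∧
      (T ⊆ T₁.1 \ T₂.1 ∧ T.card = m ∧ ∀ t ∈ T₁.1 \ T₂.1, ∀ t' ∈ T₁.1, (t' = t * Q ∨ t' = c * (t * Q)) → (t ∈ T ↔ t' ∉ T)) ∧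
      (T' ⊆ T₁.1 ∩ T₂.1 ∧ T'.card = m ∧ ∀ t ∈ T₁.1 ∩ T₂.1, ∀ t' ∈ T₁.1, (t' = t * Q ∨ t' = c * (t * Q)) → (t ∈ T' ↔ t' ∉ T')) ∧
      (∀ U : Finset G, U ⊆ T₁.1 \ T₂.1 → U.card = m →
        (∀ t ∈ T₁.1 \ T₂.1, ∀ t' ∈ T₁.1, (t' = t * Q ∨ t' = c * (t * Q)) → (t ∈ U ↔ t' ∉ U)) →
        ∀ T₃ ∈ insert T₀ ((𝒯 ∪ 𝒯').erase T₁), T₃ ≠ T₂ → 0 < (U ∩ (T₁.1 \ T₃.1)).card ∧ (U ∩ (T₁.1 \ T₃.1)).card < m) ∧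
      (∀ U' : Finset G, U' ⊆ T₁.1 ∩ T₂.1 → U'.card = m →
        (∀ t ∈ T₁.1 ∩ T₂.1, ∀ t' ∈ T₁.1, (t' = t * Q ∨ t' = c * (t * Q)) → (t ∈ U' ↔ t' ∉ U')) →
        ∀ T₃ ∈ insert T₀ ((𝒯 ∪ 𝒯').erase T₁), T₃ ≠ T₂ → 0 < (U' ∩ (T₁.1 \ T₃.1)).card ∧ (U' ∩ (T₁.1 \ T₃.1)).card < m) ∧
      (∀ T₃ ∈ insert T₀ ((𝒯 ∪ 𝒯').erase T₁), T₃ ≠ T₂ →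
        (3 ≤ (T ∩ (T₁.1 \ T₃.1)).card ∧ (T ∩ (T₁.1 \ T₃.1)).card + 3 ≤ m) ∧
        (3 ≤ (((T₁.1 \ T₂.1) \ T).image (fun x => c * x) ∩ (T₂.1 \ T₃.1)).card ∧
          (((T₁.1 \ T₂.1) \ T).image (fun x => c * x) ∩ (T₂.1 \ T₃.1)).card + 3 ≤ m) ∧
        (3 ≤ (T' ∩ (T₁.1 \ T₃.1)).card ∧ (T' ∩ (T₁.1 \ T₃.1)).card + 3 ≤ m) ∧
        (3 ≤ (((T₁.1 \ (rt c c T₂).1) \ T').image (fun x => c * x) ∩ ((rt c c T₂).1 \ T₃.1)).card ∧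
          (((T₁.1 \ (rt c c T₂).1) \ T').image (fun x => c * x) ∩ ((rt c c T₂).1 \ T₃.1)).card + 3 ≤ m))) :
    IsLeast {n : ℕ | ∃ S : Finset (CMF G c →₀ ℤ), (↑S ⊆ gfaceSet G c hc2) ∧ S.card = n ∧
      hodgeSpan c hc2 ≤ Submodule.span ℤ (pairSet c) ⊔ Submodule.span ℤ (translates c S)} (fibreTwo c hc2) := by
  classical
  refine isLeast_card_gfaces_generate_partners_mixed c hG hc2 hc1 hcen T₀ 𝒯 𝒯' h𝒯 hbase m hm hn hH hpair (fun T₁ hT₁ => ?_) (fun T₂ hT₂ => ?_)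
  · obtain ⟨Q, T, T', hQ, hQQ, hσH, ⟨hTH, hTm, hT⟩, ⟨hTH', hTm', hT'⟩, hcU, hcU', hcfar⟩ := hframe T₁ hT₁
    obtain ⟨h1, h2, h3, h4⟩ := frame_data_of_counts c hc2 hcen T₀ (𝒯 ∪ 𝒯') hbase m hm hn hH hpair (mem_union_left _ hT₁) Q T T' hTH hTm hTH' hTm'
      hcU hcU' hcfar
    exact ⟨Q, T, T', hQ, hQQ, hσH, ⟨hTH, hTm, hT⟩, ⟨hTH', hTm', hT'⟩, h1, h2, h3, h4⟩
  · obtain ⟨T₁, hT₁, Q₁, Q, T, T', hQ₁, hQ, hQQ, hσH, ⟨hTH, hTm, hT⟩, ⟨hTH', hTm', hT'⟩, hcU, hcU', hcfar⟩ := hframe' T₂ hT₂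
    have hT₁u : T₁ ∈ 𝒯 ∪ 𝒯' := mem_union_left _ hT₁
    have hbase₁ := hbase_exchange_partners c hbase hQ₁
    have hn₁ : T₁.1.card = 4 * m := card_frame c hc2 T₀ T₁ m hn
    have hH₁ := card_sdiff_exchange_partners c hc2 T₀ (𝒯 ∪ 𝒯') m hH hpair hT₁u
    have hpair₁ := pair_exchange_partners c hc2 T₀ (𝒯 ∪ 𝒯') m hH hpair T₁
    have h12 : T₂ ≠ T₁ := by
      intro h; rw [h, Finset.sdiff_self] at hTH
      have h1 := card_le_card hTH; rw [card_empty] at h1; omega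
    have hT₂' : T₂ ∈ insert T₀ ((𝒯 ∪ 𝒯').erase T₁) := mem_insert_of_mem (mem_erase.mpr ⟨h12, mem_union_right _ hT₂⟩)
    obtain ⟨h1, h2, h3, h4⟩ := frame_data_of_counts c hc2 hcen T₁ _ hbase₁ m hm hn₁ hH₁ hpair₁ hT₂' Q T T' hTH hTm hTH' hTm' hcU hcU' hcfar
    exact ⟨T₁, hT₁, Q₁, Q, T, T', hQ₁, hQ, hQQ, hσH, ⟨hTH, hTm, hT⟩, ⟨hTH', hTm', hT'⟩, h1, h2, h3, h4⟩

end

end Summit.HodgeConjecture.CorCM.Census.CentralSquares
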